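import Summits.CriticalPhenomena.Ising3DConformalLimit.Theses.EnergyNotSigmaSquared
import Summits.CriticalPhenomena.Ising3DConformalLimit.Theorems.EnergyNotSigmaSquaredEnergyGapPowerLawRayGrowth
import Summits.CriticalPhenomena.Ising3DConformalLimit.Theorems.EnergyNotSigmaSquaredEnergyGapPowerLawRayRatioPowerBound
import Summits.CriticalPhenomena.Ising3DConformalLimit.Theorems.PerfectScreeningScreeningDichotomyGreen

/-!
# `EnergyGapPowerLaw` ⟺ the PARALLEL adjacent avoidance decays as a power (one pairing suffices)
(item stmt-CriticalPhenomena-4469, route `EnergyNotSigmaSquared`, sub-problem `Ising3DConformalLimit`;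
helper file `--supports stmt-CriticalPhenomena-4469`, line `registered` of the crux)

Notation: `G = criticalTwoPoint 3`, `e₂ = Pi.single 1 1`, `β_c = criticalBeta 3`,
`T(x) = ⟨σ₀σ_{e₂}σ_xσ_{x+e₂}⟩_{β_c} − ⟨σ₀σ_{e₂}⟩⟨σ_xσ_{x+e₂}⟩`,
`P_par(x) = P^{{0}∆{x},{e₂}∆{x+e₂}}_{β_c}[0 ↔ e₂]` (two INDEPENDENT critical sourced currents `0 → x`,
`e₂ → x + e₂`, law `sourcedDoubleCurrentLawInf`), `A_par = 1 − P_par`, `G₊G₋ = G(x+e₂)G(x−e₂)`.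

The crux GAP (`∃ κ > 0, C, ∀ x ≠ 0, T(x) ≤ C‖x‖^{-κ}G(x)²`) is here reduced to the SINGLE random-current
statement "parallel adjacent avoidance decays as a power", `A_par(x) ≤ C‖x‖^{-κ}` (`x ≠ 0`), and shown
EQUIVALENT to it (`energyGapPowerLaw_iff_parAvoidancePowerLaw`).  Ingredients:

* `T = 2G²A_par + (G₊G₋ − G²)` (`adjacentTruncation_eq_ursell`, from ADC21 (3.11) and the tied pairings
  `G²P_par = G₊G₋P_cross`, `pairings_tied`), so GAP ⟸ (par decay) ∧ (power-rate log-CONCAVITY of `G`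
  along `e₂`, `G₊G₋ − G² ≤ C‖x‖^{-κ}G²`) — `gap_of_parAvoidance_of_logConcavity`;
* par decay ⟹ power-rate log-CONVEXITY `G² − G₊G₋ ≤ C‖x‖^{-κ}G²` (`logConvexity_of_parAvoidance`: by the
  tied pairings `G² − G₊G₋ = G²A_par − G₊G₋A_cross ≤ G²A_par`);
* **the quantitative ray lemma** `logConcavity_of_logConvexity`: power-rate log-convexity of `G` along
  `e₂` forces power-rate log-concavity (exponent `κ/5 ∧ 1/5`), assembled from the two abstract ray
  theorems `stub_rayGrowth` (growth along a ray) and `stub_rayRatioPowerBound` (files `…RayGrowth`,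
  `…RayRatioPowerBound`) applied to `F = G` in the directions `e₂` and `−e₂` with the GKS ceiling
  `exists_ray_ceiling`; small `x` are absorbed by `G(x+e)/G(x) ≤ G(e)⁻¹` —
  `ratioPowerBound_of_logConvexity`;
* conversely GAP ⟹ par decay since `G²A_par ≤ T` (`parAvoidancePowerLaw_of_energyGapPowerLaw`).

This is the POWER analogue of the landed `energyGapSoft_iff_parMerging` (…EnergyGapSoftParMerging) and
pays, once, the "second-ratio debt" of every one-pairing line on this crux (standing Disproof §8,
`energyGapPowerLaw_iff_par_and_ratio`: the conjunct `SecondRatioPowerRegular` is now a CONSEQUENCE of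
`ParAvoidancePowerLaw`).  Nothing here asserts the item: `ParAvoidancePowerLaw` is the open heart.

## References

* M. Aizenman, H. Duminil-Copin, Ann. of Math. 194 (2021), §3.2 eq. (3.11), Remark 5.10
  [AizenmanDuminilCopinAnnals2021].
* M. Aizenman, Comm. Math. Phys. 86 (1982) 1–48, Prop. 5.3 [AizenmanCMP1982].
-/

noncomputable section

namespace Summit.CriticalPhenomena.Ising3DConformalLimit.EnergyNotSigmaSquaredEnergyGapPowerLaw

open scoped symmDiff
open MeasureTheory
open Literature.Probability.LatticeModels Literature.Probability.Percolation
open Summit.CriticalPhenomena.Ising3DConformalLimit.Theses.EnergyNotSigmaSquared (EnergyGapPowerLaw)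
open Summit.CriticalPhenomena.Ising3DConformalLimit.EnergyNotSigmaSquaredEnergyGapSoft
  (adjacentTruncation_eq adjacentTruncation_eq_ursell pairings_tied sourcedDoubleCurrentLawInf_real_le_one
   one_sub_sourcedDoubleCurrentLawInf_real_nonneg exists_ray_ceiling criticalTwoPoint_add_mul_le)
open Summit.CriticalPhenomena.Ising3DConformalLimit.PinnedClusterPoints (criticalTwoPoint_pos3)
open Summit.CriticalPhenomena.Ising3DConformalLimit.Theorems.PerfectScreening (one_le_norm_of_ne_zero)

/-! ### Small facts -/

/-- The unit vector `e₂ = Pi.single 1 1` of `ℤ³` has sup norm one. [folklore] -/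
theorem norm_e₂_eq_one : ‖(Pi.single 1 1 : Site 3)‖ = 1 := by
  rw [Pi.norm_single]; simp

/-! ### The quantitative ray lemma for `G` -/

/-- **Power-rate log-convexity of `G` in a unit direction `e` forces a power-rate bound on the ratio
`G(x+e)/G(x)` for ALL `x ≠ 0`**: if `G(y)² − G(y+e)G(y−e) ≤ C‖y‖^{-κ}G(y)²` (`y ≠ 0`, `κ > 0`) then
`G(x+e)/G(x) ≤ 1 + C'‖x‖^{-κ'}` for some `κ' > 0`, `C'`.  Proof: normalise `κ ↦ min κ 1`, `C ↦ max C 0`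
(`‖y‖ ≥ 1`), apply the abstract ray theorems `stub_rayGrowth` / `stub_rayRatioPowerBound` to `F = G`
with the GKS ceiling `G(x+Ke) ≤ c⁻¹K²G(x)` (`exists_ray_ceiling`), and absorb `‖x‖ < R` by
`G(x+e)/G(x) ≤ G(e)⁻¹` (GKS `G(x+e)G(e) ≤ G(x)`). [cite: AizenmanDuminilCopinAnnals2021, Remark 5.10] -/
theorem ratioPowerBound_of_logConvexity {e : Site 3} (he : ‖e‖ = 1) {κ C : ℝ} (hκ : 0 < κ)
    (hconv : ∀ y : Site 3, y ≠ 0 →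
      criticalTwoPoint 3 y ^ 2 - criticalTwoPoint 3 (y + e) * criticalTwoPoint 3 (y - e) ≤
        C * (‖y‖ : ℝ) ^ (-κ) * criticalTwoPoint 3 y ^ 2) :
    ∃ κ' C' : ℝ, 0 < κ' ∧ ∀ x : Site 3, x ≠ 0 →
      criticalTwoPoint 3 (x + e) / criticalTwoPoint 3 x ≤ 1 + C' * (‖x‖ : ℝ) ^ (-κ') := by
  have hGpos : ∀ v, 0 < criticalTwoPoint 3 v := criticalTwoPoint_pos3
  -- normalise the exponent and the constant
  set κ₀ : ℝ := min κ 1 with hκ₀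
  set C₀ : ℝ := max C 0 with hC₀
  have hκ₀pos : 0 < κ₀ := lt_min hκ one_pos
  have hκ₀le : κ₀ ≤ 1 := min_le_right _ _
  have hC₀nn : 0 ≤ C₀ := le_max_right _ _
  have hconv' : ∀ y : Site 3, y ≠ 0 →
      (1 - C₀ * (‖y‖ : ℝ) ^ (-κ₀)) * criticalTwoPoint 3 y ^ 2 ≤
        criticalTwoPoint 3 (y + e) * criticalTwoPoint 3 (y - e) := by
    intro y hy
    have hy1 : 1 ≤ ‖y‖ := one_le_norm_of_ne_zero hy
    have hG2 : 0 ≤ criticalTwoPoint 3 y ^ 2 := sq_nonneg _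
    have h1 : (‖y‖ : ℝ) ^ (-κ) ≤ ‖y‖ ^ (-κ₀) :=
      Real.rpow_le_rpow_of_exponent_le hy1 (neg_le_neg (min_le_left _ _))
    have h2 : C * (‖y‖ : ℝ) ^ (-κ) ≤ C₀ * ‖y‖ ^ (-κ₀) :=
      (mul_le_mul_of_nonneg_right (le_max_left _ _) (Real.rpow_nonneg (norm_nonneg _) _)).trans
        (mul_le_mul_of_nonneg_left h1 hC₀nn)
    have h3 := hconv y hy
    nlinarith [mul_le_mul_of_nonneg_right h2 hG2]
  obtain ⟨c, hc, hceil⟩ := exists_ray_ceiling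
  obtain ⟨κ', C', R, hκ', hR⟩ := stub_rayRatioPowerBound (criticalTwoPoint 3) e he hGpos
    (fun x L a η => stub_rayGrowth (criticalTwoPoint 3) e x L a η hGpos) c hc (hceil e he) κ₀ C₀
    hκ₀pos hκ₀le hC₀nn hconv'
  -- absorb the points with `‖x‖ < R` using `G(x+e)/G(x) ≤ G(e)⁻¹`
  set R₁ : ℝ := max R 1 with hR₁
  have hR₁pos : 0 < R₁ := lt_of_lt_of_le one_pos (le_max_right _ _)
  have hGe := hGpos e
  refine ⟨κ', max C' 0 + (criticalTwoPoint 3 e)⁻¹ * R₁ ^ κ', hκ', fun x hx => ?_⟩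
  have hx1 : 1 ≤ ‖x‖ := one_le_norm_of_ne_zero hx
  have hxpos : 0 < ‖x‖ := lt_of_lt_of_le one_pos hx1
  have hρ : 0 ≤ (‖x‖ : ℝ) ^ (-κ') := Real.rpow_nonneg (norm_nonneg _) _
  have hratio_le : criticalTwoPoint 3 (x + e) / criticalTwoPoint 3 x ≤ (criticalTwoPoint 3 e)⁻¹ := by
    rw [div_le_iff₀ (hGpos x), ← div_eq_inv_mul, le_div_iff₀ hGe]
    exact criticalTwoPoint_add_mul_le x e
  have hA : 0 ≤ max C' 0 * (‖x‖ : ℝ) ^ (-κ') := mul_nonneg (le_max_right _ _) hρ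
  have hB : 0 ≤ (criticalTwoPoint 3 e)⁻¹ * R₁ ^ κ' * (‖x‖ : ℝ) ^ (-κ') :=
    mul_nonneg (mul_nonneg (inv_nonneg.2 hGe.le) (Real.rpow_nonneg hR₁pos.le _)) hρ
  by_cases hxR : R ≤ ‖x‖
  · have h := hR x hxR
    calc criticalTwoPoint 3 (x + e) / criticalTwoPoint 3 x ≤ 1 + C' * ‖x‖ ^ (-κ') := h
      _ ≤ 1 + max C' 0 * ‖x‖ ^ (-κ') := by
          gcongr; exact le_max_left _ _
      _ ≤ 1 + (max C' 0 + (criticalTwoPoint 3 e)⁻¹ * R₁ ^ κ') * ‖x‖ ^ (-κ') := by nlinarith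
  · push Not at hxR
    have hxR₁ : ‖x‖ ≤ R₁ := hxR.le.trans (le_max_left _ _)
    -- `1 ≤ R₁^κ' ‖x‖^{-κ'}`
    have hone : 1 ≤ R₁ ^ κ' * (‖x‖ : ℝ) ^ (-κ') := by
      rw [Real.rpow_neg hxpos.le, ← div_eq_mul_inv, one_le_div (Real.rpow_pos_of_pos hxpos _)]
      exact Real.rpow_le_rpow hxpos.le hxR₁ hκ'.le
    calc criticalTwoPoint 3 (x + e) / criticalTwoPoint 3 x ≤ (criticalTwoPoint 3 e)⁻¹ := hratio_le
      _ ≤ (criticalTwoPoint 3 e)⁻¹ * (R₁ ^ κ' * ‖x‖ ^ (-κ')) :=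
          le_mul_of_one_le_right (inv_nonneg.2 hGe.le) hone
      _ = (criticalTwoPoint 3 e)⁻¹ * R₁ ^ κ' * ‖x‖ ^ (-κ') := by ring
      _ ≤ 1 + (max C' 0 + (criticalTwoPoint 3 e)⁻¹ * R₁ ^ κ') * ‖x‖ ^ (-κ') := by nlinarith

/-- **The ray lemma: power-rate asymptotic log-convexity of the critical two-point function in
direction `e₂` forces power-rate asymptotic log-concavity.**  If
`G(x)² − G(x+e₂)G(x−e₂) ≤ C‖x‖^{-κ}G(x)²` for all `x ≠ 0` (`κ > 0`), then for some `κ' > 0`, `C'`,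
`G(x+e₂)G(x−e₂) − G(x)² ≤ C'‖x‖^{-κ'}G(x)²` for all `x ≠ 0`.  Proof: the convexity hypothesis is the
same statement in direction `−e₂`; `ratioPowerBound_of_logConvexity` in the directions `e₂`, `−e₂`
bounds both `G(x+e₂)/G(x)` and `G(x−e₂)/G(x)` by `1 + Mρ`, `ρ = ‖x‖^{-κ'} ≤ 1`, and
`G₊G₋/G² ≤ (1 + Mρ)² ≤ 1 + (2M + M²)ρ`. [cite: AizenmanDuminilCopinAnnals2021, Remark 5.10] -/
theorem logConcavity_of_logConvexity
    (h : ∃ κ C : ℝ, 0 < κ ∧ ∀ x : Site 3, x ≠ 0 →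
      criticalTwoPoint 3 x ^ 2 -
          criticalTwoPoint 3 (x + Pi.single 1 1) * criticalTwoPoint 3 (x - Pi.single 1 1) ≤
        C * (‖x‖ : ℝ) ^ (-κ) * criticalTwoPoint 3 x ^ 2) :
    ∃ κ C : ℝ, 0 < κ ∧ ∀ x : Site 3, x ≠ 0 →
      criticalTwoPoint 3 (x + Pi.single 1 1) * criticalTwoPoint 3 (x - Pi.single 1 1) -
          criticalTwoPoint 3 x ^ 2 ≤
        C * (‖x‖ : ℝ) ^ (-κ) * criticalTwoPoint 3 x ^ 2 := by
  obtain ⟨κ, C, hκ, hconv⟩ := h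
  have hGpos : ∀ v, 0 < criticalTwoPoint 3 v := criticalTwoPoint_pos3
  have he : ‖(Pi.single 1 1 : Site 3)‖ = 1 := norm_e₂_eq_one
  have he' : ‖(-(Pi.single 1 1) : Site 3)‖ = 1 := by rw [norm_neg, he]
  -- the convexity hypothesis in direction `-e₂` is the same statement
  have hconv' : ∀ y : Site 3, y ≠ 0 →
      criticalTwoPoint 3 y ^ 2 -
          criticalTwoPoint 3 (y + -(Pi.single 1 1)) * criticalTwoPoint 3 (y - -(Pi.single 1 1)) ≤
        C * (‖y‖ : ℝ) ^ (-κ) * criticalTwoPoint 3 y ^ 2 := by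
    intro y hy
    rw [← sub_eq_add_neg, sub_neg_eq_add, mul_comm]
    exact hconv y hy
  obtain ⟨κ₁, C₁, hκ₁, h₁⟩ := ratioPowerBound_of_logConvexity he hκ hconv
  obtain ⟨κ₂, C₂, hκ₂, h₂⟩ := ratioPowerBound_of_logConvexity he' hκ hconv'
  set κ' : ℝ := min κ₁ κ₂ with hκ'
  set M : ℝ := max C₁ 0 + max C₂ 0 with hM
  have hMnn : 0 ≤ M := add_nonneg (le_max_right _ _) (le_max_right _ _)
  refine ⟨κ', 2 * M + M ^ 2, lt_min hκ₁ hκ₂, fun x hx => ?_⟩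
  have hx1 : 1 ≤ ‖x‖ := one_le_norm_of_ne_zero hx
  have hxpos : 0 < ‖x‖ := lt_of_lt_of_le one_pos hx1
  set ρ : ℝ := (‖x‖ : ℝ) ^ (-κ') with hρ
  have hρnn : 0 ≤ ρ := Real.rpow_nonneg (norm_nonneg _) _
  have hρle : ρ ≤ 1 := Real.rpow_le_one_of_one_le_of_nonpos hx1 (neg_nonpos.2 (lt_min hκ₁ hκ₂).le)
  have hr1 : (‖x‖ : ℝ) ^ (-κ₁) ≤ ρ :=
    Real.rpow_le_rpow_of_exponent_le hx1 (neg_le_neg (min_le_left _ _))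
  have hr2 : (‖x‖ : ℝ) ^ (-κ₂) ≤ ρ :=
    Real.rpow_le_rpow_of_exponent_le hx1 (neg_le_neg (min_le_right _ _))
  -- the two ratio bounds, upgraded to the common exponent and nonnegative constants
  have hq₁ : criticalTwoPoint 3 (x + Pi.single 1 1) / criticalTwoPoint 3 x ≤ 1 + M * ρ := by
    have h := h₁ x hx
    have hup : C₁ * (‖x‖ : ℝ) ^ (-κ₁) ≤ M * ρ :=
      calc C₁ * (‖x‖ : ℝ) ^ (-κ₁) ≤ max C₁ 0 * ‖x‖ ^ (-κ₁) :=
            mul_le_mul_of_nonneg_right (le_max_left _ _) (Real.rpow_nonneg (norm_nonneg _) _)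
        _ ≤ max C₁ 0 * ρ := mul_le_mul_of_nonneg_left hr1 (le_max_right _ _)
        _ ≤ M * ρ := mul_le_mul_of_nonneg_right (by rw [hM]; linarith [le_max_right C₂ 0]) hρnn
    linarith
  have hq₂ : criticalTwoPoint 3 (x - Pi.single 1 1) / criticalTwoPoint 3 x ≤ 1 + M * ρ := by
    have h := h₂ x hx
    rw [← sub_eq_add_neg] at h
    have hup : C₂ * (‖x‖ : ℝ) ^ (-κ₂) ≤ M * ρ :=
      calc C₂ * (‖x‖ : ℝ) ^ (-κ₂) ≤ max C₂ 0 * ‖x‖ ^ (-κ₂) :=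
            mul_le_mul_of_nonneg_right (le_max_left _ _) (Real.rpow_nonneg (norm_nonneg _) _)
        _ ≤ max C₂ 0 * ρ := mul_le_mul_of_nonneg_left hr2 (le_max_right _ _)
        _ ≤ M * ρ := mul_le_mul_of_nonneg_right (by rw [hM]; linarith [le_max_right C₁ 0]) hρnn
    linarith
  -- multiply out
  have hGx := hGpos x
  have hG2 : 0 < criticalTwoPoint 3 x ^ 2 := pow_pos hGx 2
  have hqpos₂ : 0 ≤ criticalTwoPoint 3 (x - Pi.single 1 1) / criticalTwoPoint 3 x :=
    div_nonneg (hGpos _).le hGx.le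
  have hprod : criticalTwoPoint 3 (x + Pi.single 1 1) / criticalTwoPoint 3 x *
      (criticalTwoPoint 3 (x - Pi.single 1 1) / criticalTwoPoint 3 x) ≤ (1 + M * ρ) * (1 + M * ρ) :=
    mul_le_mul hq₁ hq₂ hqpos₂ (by nlinarith)
  have heq : criticalTwoPoint 3 (x + Pi.single 1 1) * criticalTwoPoint 3 (x - Pi.single 1 1) =
      criticalTwoPoint 3 (x + Pi.single 1 1) / criticalTwoPoint 3 x *
        (criticalTwoPoint 3 (x - Pi.single 1 1) / criticalTwoPoint 3 x) * criticalTwoPoint 3 x ^ 2 := by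
    field_simp
  have hsq : (1 + M * ρ) * (1 + M * ρ) ≤ 1 + (2 * M + M ^ 2) * ρ := by
    have : M ^ 2 * ρ ^ 2 ≤ M ^ 2 * ρ := by
      have hρ2 : ρ ^ 2 ≤ ρ := by nlinarith
      exact mul_le_mul_of_nonneg_left hρ2 (sq_nonneg _)
    nlinarith
  rw [heq]
  nlinarith [mul_le_mul_of_nonneg_right (hprod.trans hsq) hG2.le]

/-! ### Parallel avoidance decay ⟹ GAP -/

/-- **Tied pairings turn parallel avoidance decay into power-rate log-convexity**:
`G² − G₊G₋ = G²A_par − G₊G₋A_cross ≤ G²A_par ≤ C‖x‖^{-κ}G²`. [cite: AizenmanDuminilCopinAnnals2021, §3.2 eq. (3.11)] -/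
theorem logConvexity_of_parAvoidance
    (hpar : ∃ κ C : ℝ, 0 < κ ∧ ∀ x : Site 3, x ≠ 0 →
      1 - (sourcedDoubleCurrentLawInf 3 (criticalBeta 3) ({0} ∆ {x})
            ({(Pi.single 1 1 : Site 3)} ∆ {x + Pi.single 1 1})).real (openConn 0 (Pi.single 1 1)) ≤
        C * (‖x‖ : ℝ) ^ (-κ)) :
    ∃ κ C : ℝ, 0 < κ ∧ ∀ x : Site 3, x ≠ 0 →
      criticalTwoPoint 3 x ^ 2 -
          criticalTwoPoint 3 (x + Pi.single 1 1) * criticalTwoPoint 3 (x - Pi.single 1 1) ≤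
        C * (‖x‖ : ℝ) ^ (-κ) * criticalTwoPoint 3 x ^ 2 := by
  obtain ⟨κ, C, hκ, hC⟩ := hpar
  refine ⟨κ, C, hκ, fun x hx => ?_⟩
  have htie := (pairings_tied x).1
  have hA := hC x hx
  have hG2 : 0 ≤ criticalTwoPoint 3 x ^ 2 := sq_nonneg _
  have hGG : 0 ≤ criticalTwoPoint 3 (x + Pi.single 1 1) * criticalTwoPoint 3 (x - Pi.single 1 1) :=
    mul_nonneg (criticalTwoPoint_nonneg' _) (criticalTwoPoint_nonneg' _)
  have hPc : (sourcedDoubleCurrentLawInf 3 (criticalBeta 3) ({0} ∆ {x + Pi.single 1 1})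
      ({(Pi.single 1 1 : Site 3)} ∆ {x})).real (openConn 0 (Pi.single 1 1)) ≤ 1 :=
    sourcedDoubleCurrentLawInf_real_le_one _ _ _ _
  set Pp := (sourcedDoubleCurrentLawInf 3 (criticalBeta 3) ({0} ∆ {x})
      ({(Pi.single 1 1 : Site 3)} ∆ {x + Pi.single 1 1})).real (openConn 0 (Pi.single 1 1)) with hPp
  set Pc := (sourcedDoubleCurrentLawInf 3 (criticalBeta 3) ({0} ∆ {x + Pi.single 1 1})
      ({(Pi.single 1 1 : Site 3)} ∆ {x})).real (openConn 0 (Pi.single 1 1)) with hPc'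
  set G2 := criticalTwoPoint 3 x ^ 2 with hG2'
  set GG := criticalTwoPoint 3 (x + Pi.single 1 1) * criticalTwoPoint 3 (x - Pi.single 1 1) with hGG'
  have h1 : GG * Pc ≤ GG := mul_le_of_le_one_right hGG hPc
  have h2 : G2 * (1 - Pp) ≤ G2 * (C * ‖x‖ ^ (-κ)) := mul_le_mul_of_nonneg_left hA hG2
  calc G2 - GG ≤ G2 - GG * Pc := by linarith
    _ = G2 * (1 - Pp) := by rw [← htie]; ring
    _ ≤ G2 * (C * ‖x‖ ^ (-κ)) := h2
    _ = C * ‖x‖ ^ (-κ) * G2 := by ring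

/-- **GAP from parallel avoidance decay and power-rate log-concavity** (the assembly algebra
`T = 2G²A_par + (G₊G₋ − G²)`, exponents merged by `‖x‖ ≥ 1`: `κ = min κ₁ κ₂`,
`C = 2 max(C₁,0) + max(C₂,0)`). [cite: AizenmanDuminilCopinAnnals2021, §3.2 eq. (3.11)] -/
theorem gap_of_parAvoidance_of_logConcavity
    (hpar : ∃ κ C : ℝ, 0 < κ ∧ ∀ x : Site 3, x ≠ 0 →
      1 - (sourcedDoubleCurrentLawInf 3 (criticalBeta 3) ({0} ∆ {x})
            ({(Pi.single 1 1 : Site 3)} ∆ {x + Pi.single 1 1})).real (openConn 0 (Pi.single 1 1)) ≤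
        C * (‖x‖ : ℝ) ^ (-κ))
    (hconc : ∃ κ C : ℝ, 0 < κ ∧ ∀ x : Site 3, x ≠ 0 →
      criticalTwoPoint 3 (x + Pi.single 1 1) * criticalTwoPoint 3 (x - Pi.single 1 1) -
          criticalTwoPoint 3 x ^ 2 ≤
        C * (‖x‖ : ℝ) ^ (-κ) * criticalTwoPoint 3 x ^ 2) :
    EnergyGapPowerLaw := by
  obtain ⟨κ₁, C₁, hκ₁, h₁⟩ := hpar
  obtain ⟨κ₂, C₂, hκ₂, h₂⟩ := hconc
  refine ⟨min κ₁ κ₂, 2 * max C₁ 0 + max C₂ 0, lt_min hκ₁ hκ₂, fun x hx => ?_⟩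
  have hx1 : 1 ≤ ‖x‖ := one_le_norm_of_ne_zero hx
  have hxpos : 0 < ‖x‖ := by linarith
  have hG2 : 0 ≤ criticalTwoPoint 3 x ^ 2 := sq_nonneg _
  have hA := h₁ x hx
  have hS := h₂ x hx
  have hr1 : ‖x‖ ^ (-κ₁) ≤ ‖x‖ ^ (-(min κ₁ κ₂)) :=
    Real.rpow_le_rpow_of_exponent_le hx1 (neg_le_neg (min_le_left _ _))
  have hr2 : ‖x‖ ^ (-κ₂) ≤ ‖x‖ ^ (-(min κ₁ κ₂)) :=
    Real.rpow_le_rpow_of_exponent_le hx1 (neg_le_neg (min_le_right _ _))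
  have hρ1 : 0 ≤ ‖x‖ ^ (-κ₁) := Real.rpow_nonneg hxpos.le _
  have hρ2 : 0 ≤ ‖x‖ ^ (-κ₂) := Real.rpow_nonneg hxpos.le _
  have hρ : 0 ≤ ‖x‖ ^ (-(min κ₁ κ₂)) := Real.rpow_nonneg hxpos.le _
  set Pp := (sourcedDoubleCurrentLawInf 3 (criticalBeta 3) ({0} ∆ {x})
      ({(Pi.single 1 1 : Site 3)} ∆ {x + Pi.single 1 1})).real (openConn 0 (Pi.single 1 1)) with hPp
  set G2 := criticalTwoPoint 3 x ^ 2 with hG2'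
  set GG := criticalTwoPoint 3 (x + Pi.single 1 1) * criticalTwoPoint 3 (x - Pi.single 1 1) with hGG'
  set ρ := ‖x‖ ^ (-(min κ₁ κ₂)) with hρ'
  have hA' : 1 - Pp ≤ max C₁ 0 * ρ :=
    hA.trans ((mul_le_mul_of_nonneg_right (le_max_left _ _) hρ1).trans
      (mul_le_mul_of_nonneg_left hr1 (le_max_right _ _)))
  have hS' : GG - G2 ≤ max C₂ 0 * ρ * G2 :=
    hS.trans (mul_le_mul_of_nonneg_right ((mul_le_mul_of_nonneg_right (le_max_left _ _) hρ2).trans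
      (mul_le_mul_of_nonneg_left hr2 (le_max_right _ _))) hG2)
  have h4 : G2 * (1 - Pp) ≤ G2 * (max C₁ 0 * ρ) := mul_le_mul_of_nonneg_left hA' hG2
  -- `T = G² (1 - 2 P_par) + G₊G₋ = 2 G² (1 - P_par) + (G₊G₋ - G²)`
  rw [adjacentTruncation_eq_ursell]
  show G2 * (1 - 2 * Pp) + GG ≤ (2 * max C₁ 0 + max C₂ 0) * ρ * G2
  nlinarith [h4, hS']

/-- **One pairing suffices: parallel adjacent avoidance decay implies `EnergyGapPowerLaw`.**
If `1 − P^{{0}∆{x},{e₂}∆{x+e₂}}_{β_c}[0 ↔ e₂] ≤ C‖x‖^{-κ}` for all `x ≠ 0` (`κ > 0`), then the crux GAP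
holds: log-convexity from the tied pairings, log-concavity from the ray lemma, and the assembly
`T = 2G²A_par + (G₊G₋ − G²)`. [cite: AizenmanDuminilCopinAnnals2021, §3.2 eq. (3.11), Remark 5.10] -/
theorem energyGapPowerLaw_of_parAvoidancePowerLaw
    (hpar : ∃ κ C : ℝ, 0 < κ ∧ ∀ x : Site 3, x ≠ 0 →
      1 - (sourcedDoubleCurrentLawInf 3 (criticalBeta 3) ({0} ∆ {x})
            ({(Pi.single 1 1 : Site 3)} ∆ {x + Pi.single 1 1})).real (openConn 0 (Pi.single 1 1)) ≤
        C * (‖x‖ : ℝ) ^ (-κ)) :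
    EnergyGapPowerLaw :=
  gap_of_parAvoidance_of_logConcavity hpar
    (logConcavity_of_logConvexity (logConvexity_of_parAvoidance hpar))

/-! ### GAP ⟹ parallel avoidance decay, and the equivalence -/

/-- **GAP forces parallel adjacent avoidance decay**: `G(x)²A_par(x) ≤ T(x) ≤ C‖x‖^{-κ}G(x)²` by the
factorisation `T = G²A_par + G₊G₋A_cross` with both terms nonnegative, and `G(x) > 0`.
[cite: AizenmanDuminilCopinAnnals2021, §3.2 eq. (3.11)] -/
theorem parAvoidancePowerLaw_of_energyGapPowerLaw (hgap : EnergyGapPowerLaw) :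
    ∃ κ C : ℝ, 0 < κ ∧ ∀ x : Site 3, x ≠ 0 →
      1 - (sourcedDoubleCurrentLawInf 3 (criticalBeta 3) ({0} ∆ {x})
            ({(Pi.single 1 1 : Site 3)} ∆ {x + Pi.single 1 1})).real (openConn 0 (Pi.single 1 1)) ≤
        C * (‖x‖ : ℝ) ^ (-κ) := by
  obtain ⟨κ, C, hκ, hC⟩ := hgap
  refine ⟨κ, C, hκ, fun x hx => ?_⟩
  have hT := hC x hx
  rw [adjacentTruncation_eq] at hT
  have hG2 : 0 < criticalTwoPoint 3 x ^ 2 := pow_pos (criticalTwoPoint_pos3 x) 2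
  have hcross : 0 ≤ criticalTwoPoint 3 (x + Pi.single 1 1) * criticalTwoPoint 3 (x - Pi.single 1 1) *
      (1 - (sourcedDoubleCurrentLawInf 3 (criticalBeta 3) ({0} ∆ {x + Pi.single 1 1})
        ({(Pi.single 1 1 : Site 3)} ∆ {x})).real (openConn 0 (Pi.single 1 1))) :=
    mul_nonneg (mul_nonneg (criticalTwoPoint_nonneg' _) (criticalTwoPoint_nonneg' _))
      (one_sub_sourcedDoubleCurrentLawInf_real_nonneg _ _ _ _)
  have h1 : criticalTwoPoint 3 x ^ 2 *
      (1 - (sourcedDoubleCurrentLawInf 3 (criticalBeta 3) ({0} ∆ {x})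
        ({(Pi.single 1 1 : Site 3)} ∆ {x + Pi.single 1 1})).real (openConn 0 (Pi.single 1 1))) ≤
      criticalTwoPoint 3 x ^ 2 * (C * ‖x‖ ^ (-κ)) := by
    linarith
  exact le_of_mul_le_mul_left h1 hG2

/-- **`EnergyGapPowerLaw` ⟺ parallel adjacent avoidance decays as a power** ("ε is not σ²" on `ℤ³`
is exactly the statement that two independent critical sourced currents `0 → x`, `e₂ → x + e₂` avoid
each other — no `0 ↔ e₂` connection in `n̂₁ ∪ n̂₂` — with polynomially small probability): the power
analogue of `energyGapSoft_iff_parMerging`. [cite: AizenmanDuminilCopinAnnals2021, §3.2 eq. (3.11), Remark 5.10] -/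
theorem energyGapPowerLaw_iff_parAvoidancePowerLaw :
    EnergyGapPowerLaw ↔
      ∃ κ C : ℝ, 0 < κ ∧ ∀ x : Site 3, x ≠ 0 →
        1 - (sourcedDoubleCurrentLawInf 3 (criticalBeta 3) ({0} ∆ {x})
              ({(Pi.single 1 1 : Site 3)} ∆ {x + Pi.single 1 1})).real (openConn 0 (Pi.single 1 1)) ≤
          C * (‖x‖ : ℝ) ^ (-κ) :=
  ⟨parAvoidancePowerLaw_of_energyGapPowerLaw, energyGapPowerLaw_of_parAvoidancePowerLaw⟩

/-- **Registered stub `stub_onePairingReduction` of the crux skeleton (line `registered`,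
`Cruxes/EnergyGapPowerLaw/Lines/birth.lean`)**: parallel adjacent avoidance decay implies the crux —
`energyGapPowerLaw_of_parAvoidancePowerLaw` with the crux `EnergyGapPowerLaw` unfolded.
[cite: AizenmanDuminilCopinAnnals2021, §3.2 eq. (3.11), Remark 5.10] -/
theorem stub_onePairingReduction :
    (∃ κ C : ℝ, 0 < κ ∧ ∀ x : Site 3, x ≠ 0 →
      1 - (sourcedDoubleCurrentLawInf 3 (criticalBeta 3) ({0} ∆ {x})
            ({(Pi.single 1 1 : Site 3)} ∆ {x + Pi.single 1 1})).real (openConn 0 (Pi.single 1 1)) ≤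
        C * (‖x‖ : ℝ) ^ (-κ)) →
    ∃ κ C : ℝ, 0 < κ ∧ ∀ x : Site 3, x ≠ 0 →
      criticalCorr 3 4 ![0, (Pi.single 1 1 : Site 3), x, x + Pi.single 1 1] -
          criticalCorr 3 2 ![0, (Pi.single 1 1 : Site 3)] * criticalCorr 3 2 ![x, x + Pi.single 1 1] ≤
        C * (‖x‖ : ℝ) ^ (-κ) * criticalTwoPoint 3 x ^ 2 :=
  fun hpar => energyGapPowerLaw_of_parAvoidancePowerLaw hpar

end Summit.CriticalPhenomena.Ising3DConformalLimit.EnergyNotSigmaSquaredEnergyGapPowerLaw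

end
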